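import Summits.Ventures.HodgeRepro2.T5InertGlobalToLocal

/-!
# T5InertGlobalPrime — «`v` stays prime in `L`» gives `e(w/v) = 1`, `f(w/v) = [L : K]`, and the
local degree `[L_w : K_v] = [L : K]`

Tier-5 kernel support (N3, the inert places) — p8, gen 15.  §8(d): uses an L-value-free
non-vanishing device: NO.

The record says «`v` inert in `E`»: the prime `v` of `F` stays prime in `E`, i.e.
`v 𝒪_E = w` for the unique prime `w` above it.  In Mathlib's vocabulary that is the hypothesis
`hmap : v.asIdeal.map (algebraMap (𝓞 K) (𝓞 L)) = w.asIdeal`.  This file derives from it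
* `ramificationIdx'_eq_one_of_staysPrime` — `e(w/v) = 1` (`Ideal.ramificationIdx'_spec` with
  `w ≠ w²`, `Ideal.pow_lt_self`);
* `primesOverFinset_eq_singleton_of_staysPrime` — `w` is the only prime over `v`;
* `inertiaDeg'_eq_finrank_of_staysPrime` — `f(w/v) = [L : K]` (Mathlib's
  `Ideal.sum_ramification_inertia` on the singleton);
* `finrank_adicCompletion_eq_finrank_of_staysPrime` — `[L_w : K_v] = [L : K]`
  (`T5InertGlobalToLocal.finrank_adicCompletion_eq_mul`);
and, for a quadratic `L / K` (`[L : K] = 2`), the inert-place package's hypotheses on the record's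
local fields from `hmap` alone: `[L_w : K_v] = 2`, `hunr` on `𝒪_{E_v} = integralClosure O_Kv L_w`,
`L_w / K_v` Galois with a non-trivial automorphism, residue degree `2`.

Nothing here asserts which places of the datum's `F` are inert in `E`: that identification remains
the record's (N3's).
-/

namespace Summit.Ventures.HodgeRepro2.T5InertGlobalPrime

open IsDedekindDomain HeightOneSpectrum NumberField

variable {K : Type*} [Field K] [NumberField K] (v : HeightOneSpectrum (RingOfIntegers K))
variable {L : Type*} [Field L] [NumberField L] [Algebra K L]
  (w : HeightOneSpectrum (RingOfIntegers L))

section Global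

omit [NumberField K] in
/-- If `v` stays prime — `v 𝒪_L = w` — then `e(w/v) = 1`: `v 𝒪_L = w ≤ w¹` and `w ≰ w²`. -/
theorem ramificationIdx'_eq_one_of_staysPrime
    (hmap : v.asIdeal.map (algebraMap (𝓞 K) (𝓞 L)) = w.asIdeal) :
    v.asIdeal.ramificationIdx' w.asIdeal = 1 := by
  refine Ideal.ramificationIdx'_spec (n := 1) ?_ ?_
  · rw [hmap, pow_one]
  · rw [hmap]
    exact not_le_of_gt (Ideal.pow_lt_self w.asIdeal w.ne_bot w.isPrime.ne_top 2 le_rfl)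

variable [w.asIdeal.LiesOver v.asIdeal]

/-- If `v` stays prime then `w` is the only prime of `L` above `v`: a prime `P` over `v` contains
`v 𝒪_L = w`, and `w` is maximal. -/
theorem primesOverFinset_eq_singleton_of_staysPrime
    (hmap : v.asIdeal.map (algebraMap (𝓞 K) (𝓞 L)) = w.asIdeal) :
    IsDedekindDomain.primesOverFinset v.asIdeal (𝓞 L) = {w.asIdeal} := by
  haveI : v.asIdeal.IsMaximal := v.isMaximal
  ext P
  rw [IsDedekindDomain.mem_primesOverFinset_iff v.ne_bot, Finset.mem_singleton]
  constructor
  · rintro ⟨hP, hPv⟩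
    have hle : w.asIdeal ≤ P := by
      rw [← hmap, Ideal.map_le_iff_le_comap]
      exact le_of_eq hPv.over
    exact (w.isMaximal.eq_of_le hP.ne_top hle).symm
  · rintro rfl
    exact ⟨w.isPrime, inferInstance⟩

/-- If `v` stays prime then `f(w/v) = [L : K]`: Mathlib's `Σ_{P ∣ v} e(P/v) f(P/v) = [L : K]`
reduces to the single term `1 · f(w/v)`. -/
theorem inertiaDeg'_eq_finrank_of_staysPrime
    (hmap : v.asIdeal.map (algebraMap (𝓞 K) (𝓞 L)) = w.asIdeal) :
    v.asIdeal.inertiaDeg' w.asIdeal = Module.finrank K L := by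
  haveI : v.asIdeal.IsMaximal := v.isMaximal
  have h := Ideal.sum_ramification_inertia (𝓞 L) K L (p := v.asIdeal) v.ne_bot
  rw [primesOverFinset_eq_singleton_of_staysPrime v w hmap, Finset.sum_singleton,
    ramificationIdx'_eq_one_of_staysPrime v w hmap, one_mul] at h
  exact h

/-- If `v` stays prime and `L / K` is quadratic then `f(w/v) = 2`. -/
theorem inertiaDeg'_eq_two_of_staysPrime (h2 : Module.finrank K L = 2)
    (hmap : v.asIdeal.map (algebraMap (𝓞 K) (𝓞 L)) = w.asIdeal) :
    v.asIdeal.inertiaDeg' w.asIdeal = 2 :=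
  (inertiaDeg'_eq_finrank_of_staysPrime v w hmap).trans h2

end Global

section Local

variable [w.asIdeal.LiesOver v.asIdeal]

/-- If `v` stays prime then the local degree is the global one: `[L_w : K_v] = [L : K]`
(`T5InertGlobalToLocal.finrank_adicCompletion_eq_mul` with `e = 1`, `f = [L : K]`). -/
theorem finrank_adicCompletion_eq_finrank_of_staysPrime
    (hmap : v.asIdeal.map (algebraMap (𝓞 K) (𝓞 L)) = w.asIdeal) :
    Module.finrank (v.adicCompletion K) (w.adicCompletion L) = Module.finrank K L := by
  rw [T5InertGlobalToLocal.finrank_adicCompletion_eq_mul v w,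
    ramificationIdx'_eq_one_of_staysPrime v w hmap, inertiaDeg'_eq_finrank_of_staysPrime v w hmap, one_mul]

/-- Quadratic case: if `v` stays prime in the quadratic `L / K` then `[L_w : K_v] = 2`. -/
theorem finrank_adicCompletion_eq_two_of_staysPrime (h2 : Module.finrank K L = 2)
    (hmap : v.asIdeal.map (algebraMap (𝓞 K) (𝓞 L)) = w.asIdeal) :
    Module.finrank (v.adicCompletion K) (w.adicCompletion L) = 2 :=
  (finrank_adicCompletion_eq_finrank_of_staysPrime v w hmap).trans h2

/-- If `v` stays prime, every uniformiser of `O_Kv` stays a uniformiser of `O_Lw`. -/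
theorem irreducible_algebraMap_of_staysPrime
    (hmap : v.asIdeal.map (algebraMap (𝓞 K) (𝓞 L)) = w.asIdeal) {ϖ : v.adicCompletionIntegers K}
    (hϖ : Irreducible ϖ) :
    Irreducible (algebraMap (v.adicCompletionIntegers K) (w.adicCompletionIntegers L) ϖ) :=
  T5InertGlobalToLocal.irreducible_algebraMap_of_ramificationIdx'_eq_one v w
    (ramificationIdx'_eq_one_of_staysPrime v w hmap) hϖ

/-- The `hunr` hypothesis of the inert-place package on the record's local fields from
«`v` stays prime»: `𝔭 𝒪_{E_v} = 𝔭_{E_v}` for `𝒪_{E_v} = integralClosure O_Kv L_w`. -/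
theorem map_maximalIdeal_integralClosure_eq_of_staysPrime
    (hmap : v.asIdeal.map (algebraMap (𝓞 K) (𝓞 L)) = w.asIdeal) {ϖ : v.adicCompletionIntegers K}
    (hϖ : Irreducible ϖ) :
    haveI := T5InertPlaceCompletion.isLocalRing_integralClosure_adicCompletion v w
    Ideal.map (algebraMap (v.adicCompletionIntegers K)
        (integralClosure (v.adicCompletionIntegers K) (w.adicCompletion L)))
      (IsLocalRing.maximalIdeal (v.adicCompletionIntegers K)) =
      IsLocalRing.maximalIdeal
        (integralClosure (v.adicCompletionIntegers K) (w.adicCompletion L)) :=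
  T5InertGlobalToLocal.map_maximalIdeal_integralClosure_eq_of_inert v w
    (ramificationIdx'_eq_one_of_staysPrime v w hmap) hϖ

/-- If `v` stays prime in the quadratic `L / K` then `L_w / K_v` is Galois. -/
theorem isGalois_adicCompletion_of_staysPrime (h2 : Module.finrank K L = 2)
    (hmap : v.asIdeal.map (algebraMap (𝓞 K) (𝓞 L)) = w.asIdeal) :
    IsGalois (v.adicCompletion K) (w.adicCompletion L) :=
  T5InertPlaceCompletion.isGalois_adicCompletion v w
    (finrank_adicCompletion_eq_two_of_staysPrime v w h2 hmap)

/-- If `v` stays prime in the quadratic `L / K` then `L_w / K_v` has a non-trivial automorphism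
(the Galois conjugation the inert-place package takes as its star). -/
theorem exists_algEquiv_ne_one_of_staysPrime (h2 : Module.finrank K L = 2)
    (hmap : v.asIdeal.map (algebraMap (𝓞 K) (𝓞 L)) = w.asIdeal) :
    ∃ σ : w.adicCompletion L ≃ₐ[v.adicCompletion K] w.adicCompletion L, σ ≠ 1 :=
  T5InertPlaceCompletion.exists_algEquiv_ne_one v w
    (finrank_adicCompletion_eq_two_of_staysPrime v w h2 hmap)

/-- If `v` stays prime in the quadratic `L / K` then the residue field of `O_Lw` has degree `2`
over that of `O_Kv`. -/
theorem finrank_residueField_eq_two_of_staysPrime (h2 : Module.finrank K L = 2)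
    (hmap : v.asIdeal.map (algebraMap (𝓞 K) (𝓞 L)) = w.asIdeal) :
    Module.finrank (IsLocalRing.ResidueField (v.adicCompletionIntegers K))
      (IsLocalRing.ResidueField (w.adicCompletionIntegers L)) = 2 :=
  T5InertGlobalToLocal.finrank_residueField_eq_two_of_inert v w
    (inertiaDeg'_eq_two_of_staysPrime v w h2 hmap)

end Local

end Summit.Ventures.HodgeRepro2.T5InertGlobalPrime
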